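import Summits.AtomisticToContinuum.Crystallization.Theorems.FrustratedLawDichotomyCoherentFloor

/-!
# DROWS-SOUND, the analytic assembly: window sum minus far-field envelope ≤ twice the root energy

decomp-a2c hand-2 g46 — structural share for `AperiodicFrustratedLawGap` (stmt-27623), class-D rows (critic r1757 (C)(b) «DROWS-SOUND»;
readings of the three K certificates = `…DRowsBccSound` / `…DRowsA15Sound` / `…DRowsC15Sound`).  Those readings deliver, per leaf and scale `s`,
`e⋆ + 27/1000 ≤ ½·(booked window sum) − (1/12)·Env₆(δ, R)` with `δ = s_lo`, `R = 10·s_lo/s_hi`.  This file is the LAW-FREE, TEMPLATE-FREE half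
of the remaining bridge to `rootEnergy`: for ANY `δ`-separated configuration `S ∋ 0` and ANY finite set `W ⊆ S ∖ {0}` of «window» atoms such
that every other atom of `S ∖ {0}` is at distance `≥ R` from the root (`R ≥ 1`, `R ≥ δ/2`),

  `Σ_{z ∈ W} V_LJ ‖z‖ − (1/6)·Env₆(δ, R) ≤ 2·rootEnergy V_LJ (count⌊S)`      (`sum_sub_env_le_two_mul_rootEnergy`),

`Env₆(δ,R) = (2/δ)³R⁻³ + (15/2)(2/δ)²R⁻⁴ + (3/5)(2/δ)R⁻⁵ + 2R⁻⁶` (the `k = 3` instance of TREE `…FarFieldSharp.sum_inv_pow_le_of_separated_sharp`).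
Ingredients: `setLIntegral_enorm_lennardJones_le_env` — the `δ`-GENERIC twin of (226)'s `setLIntegral_enorm_lennardJones_compl_le` (there `δ = 7/10`
and the region is a ball complement; here any measurable region whose atoms are `≥ R` from the root), the finite-window integral as a `Finset` sum
(Literature `integral_count_restrict_coe_finset`), and integrability of `V_LJ ‖·‖` on `count⌊S` from the two pieces.
What then remains of DROWS-SOUND is (s1) alone: for the scaled template `S = s·Λ` rooted at a class representative, exhibit `W` = the atoms inside the
cut and identify `Σ_{z ∈ W} V_LJ ‖z‖ = Σ_{(D,m) ∈ H, inside} m·φ(s²·D/den)` (true shell multiplicities) — K side / template definition.  DEF-FREE.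
-/

namespace Summit.AtomisticToContinuum.Crystallization.Theorems.FrustratedLawDichotomyDRowsAssembly

open MeasureTheory Metric Set
open scoped BigOperators ENNReal
open Literature.MathematicalPhysics.StatisticalMechanics (lennardJones rootEnergy rootEnergy_def integral_count_restrict_coe_finset
  count_restrict_coe_finset)
open Summit.AtomisticToContinuum.Crystallization.Theorems.ChargedEnergyGapNegative (E3)
open Summit.AtomisticToContinuum.Crystallization.Theorems.FrustratedLawDichotomyFarFieldSharp (sum_inv_pow_le_of_separated_sharp)
open Summit.AtomisticToContinuum.Crystallization.Theorems.FrustratedLawDichotomyTransportPriceTail (countable_of_separated)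

/-! ## §1 The far-field envelope on a region of far atoms (`δ` generic) -/

/-- ★ `∫⁻_{A} ‖V_LJ ‖z‖‖ₑ d(count⌊S) ≤ (1/6)·Env₆(δ, R)` for a `δ`-separated `S` and a measurable region `A` all of whose atoms are `≥ R ≥ 1`
from the root (`δ/2 ≤ R`): `|V_LJ(r)| ≤ r⁻⁶/6` beyond `1` and the sharp far-field sum on every finite subset. [folklore] -/
theorem setLIntegral_enorm_lennardJones_le_env {S A : Set E3} {δ R : ℝ} (hδ : 0 < δ)
    (hS : ∀ p ∈ S, ∀ p' ∈ S, p ≠ p' → δ ≤ dist p p') (hA : MeasurableSet A)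
    (hfar : ∀ z ∈ A ∩ S, R ≤ ‖z‖) (hR1 : 1 ≤ R) (hR : δ / 2 ≤ R) :
    ∫⁻ z in A, ‖lennardJones ‖z‖‖ₑ ∂(Measure.count.restrict S : Measure E3) ≤
      ENNReal.ofReal (1 / 6 * ((2 / δ) ^ 3 * R⁻¹ ^ 3 + 15 / 2 * (2 / δ) ^ 2 * R⁻¹ ^ 4 + 3 / 5 * (2 / δ) * R⁻¹ ^ 5 + 2 * R⁻¹ ^ 6)) := by
  classical
  have hSc : (A ∩ S).Countable := (countable_of_separated hδ hS).mono inter_subset_right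
  rw [Measure.restrict_restrict hA, lintegral_countable _ hSc]
  simp only [Measure.count_singleton, mul_one]
  refine ENNReal.summable.tsum_le_of_sum_le fun t => ?_
  set t' : Finset E3 := t.map (Function.Embedding.subtype _) with ht'
  have hmem : ∀ z ∈ t', R ≤ ‖z‖ ∧ z ∈ S := fun z hz => by
    obtain ⟨w, -, rfl⟩ := Finset.mem_map.mp hz
    exact ⟨hfar w w.2, w.2.2⟩
  have hpt : ∀ z ∈ t', ‖lennardJones ‖z‖‖ₑ ≤ ENNReal.ofReal (1 / 6 * ‖z‖⁻¹ ^ 6) := fun z hz => by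
    rw [Real.enorm_eq_ofReal_abs]
    exact ENNReal.ofReal_le_ofReal (LoopTunnelDialRangeTails.abs_lennardJones_le_of_one_le (hR1.trans (hmem z hz).1))
  have hsum : ∑ w ∈ t, ‖lennardJones ‖(w : E3)‖‖ₑ = ∑ z ∈ t', ‖lennardJones ‖z‖‖ₑ := by
    rw [ht', Finset.sum_map]; rfl
  rw [hsum]
  calc ∑ z ∈ t', ‖lennardJones ‖z‖‖ₑ ≤ ∑ z ∈ t', ENNReal.ofReal (1 / 6 * ‖z‖⁻¹ ^ 6) := Finset.sum_le_sum hpt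
    _ = ENNReal.ofReal (∑ z ∈ t', 1 / 6 * ‖z‖⁻¹ ^ 6) := (ENNReal.ofReal_sum_of_nonneg fun z _ => by positivity).symm
    _ ≤ _ := ENNReal.ofReal_le_ofReal ?_
  have h2 := sum_inv_pow_le_of_separated_sharp t' (0 : E3) (k := 3) (R := R) (by norm_num) hδ hR
    (fun z hz z' hz' hzz' => hS z (hmem z hz).2 z' (hmem z' hz').2 hzz')
    (fun z hz => by rw [dist_zero_right]; exact (hmem z hz).1)
  calc ∑ z ∈ t', 1 / 6 * ‖z‖⁻¹ ^ 6 = 1 / 6 * ∑ z ∈ t', (dist z (0 : E3))⁻¹ ^ (3 + 3) := by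
        rw [Finset.mul_sum]
        exact Finset.sum_congr rfl fun z _ => by rw [dist_zero_right]
    _ ≤ 1 / 6 * (3 / ((3 : ℕ) : ℝ) * (2 / δ) ^ 3 * R⁻¹ ^ 3 +
          6 * (((3 : ℕ) : ℝ) + 2) / (((3 : ℕ) : ℝ) + 1) * (2 / δ) ^ 2 * R⁻¹ ^ (3 + 1) +
          3 / (((3 : ℕ) : ℝ) + 2) * (2 / δ) * R⁻¹ ^ (3 + 2) + 2 * R⁻¹ ^ (3 + 3)) := by gcongr
    _ = _ := by push_cast; ring

/-- the signed tail: `−(1/6)·Env₆(δ, R) ≤ ∫_{A} V_LJ ‖z‖ d(count⌊S)` under the same hypotheses. [folklore] -/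
theorem neg_env_le_setIntegral_lennardJones {S A : Set E3} {δ R : ℝ} (hδ : 0 < δ)
    (hS : ∀ p ∈ S, ∀ p' ∈ S, p ≠ p' → δ ≤ dist p p') (hA : MeasurableSet A)
    (hfar : ∀ z ∈ A ∩ S, R ≤ ‖z‖) (hR1 : 1 ≤ R) (hR : δ / 2 ≤ R) :
    -(1 / 6 * ((2 / δ) ^ 3 * R⁻¹ ^ 3 + 15 / 2 * (2 / δ) ^ 2 * R⁻¹ ^ 4 + 3 / 5 * (2 / δ) * R⁻¹ ^ 5 + 2 * R⁻¹ ^ 6)) ≤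
      ∫ z in A, lennardJones ‖z‖ ∂(Measure.count.restrict S : Measure E3) := by
  have hRpos : 0 < R := by linarith
  have h0 : 0 ≤ 1 / 6 * ((2 / δ) ^ 3 * R⁻¹ ^ 3 + 15 / 2 * (2 / δ) ^ 2 * R⁻¹ ^ 4 + 3 / 5 * (2 / δ) * R⁻¹ ^ 5 + 2 * R⁻¹ ^ 6) := by
    have : 0 ≤ R⁻¹ := inv_nonneg.2 hRpos.le
    positivity
  have habs : |∫ z in A, lennardJones ‖z‖ ∂(Measure.count.restrict S : Measure E3)| ≤
      1 / 6 * ((2 / δ) ^ 3 * R⁻¹ ^ 3 + 15 / 2 * (2 / δ) ^ 2 * R⁻¹ ^ 4 + 3 / 5 * (2 / δ) * R⁻¹ ^ 5 + 2 * R⁻¹ ^ 6) := by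
    rw [← Real.norm_eq_abs]
    refine (norm_integral_le_lintegral_norm _).trans ?_
    simp_rw [ofReal_norm]
    calc (∫⁻ z in A, ‖lennardJones ‖z‖‖ₑ ∂(Measure.count.restrict S : Measure E3)).toReal
        ≤ (ENNReal.ofReal (1 / 6 * ((2 / δ) ^ 3 * R⁻¹ ^ 3 + 15 / 2 * (2 / δ) ^ 2 * R⁻¹ ^ 4 + 3 / 5 * (2 / δ) * R⁻¹ ^ 5 +
            2 * R⁻¹ ^ 6))).toReal :=
          ENNReal.toReal_mono ENNReal.ofReal_ne_top (setLIntegral_enorm_lennardJones_le_env hδ hS hA hfar hR1 hR)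
      _ = _ := ENNReal.toReal_ofReal h0
  exact (abs_le.mp habs).1

/-! ## §2 Window plus tail -/

/-- `z ↦ V_LJ ‖z‖` is measurable (file-local copy; the same one-liner exists in another route's chain, outside this cone). [folklore] -/
private theorem measurable_lennardJones_norm : Measurable fun z : E3 => lennardJones ‖z‖ := by
  unfold lennardJones
  exact ((measurable_norm.inv.pow_const 12).const_mul _).sub ((measurable_norm.inv.pow_const 6).const_mul _)

/-- on a finite set of its atoms, the configuration is the counting measure of that set. [folklore] -/
theorem restrict_coe_finset_eq {S : Set E3} (B : Finset E3) (hB : (↑B : Set E3) ⊆ S) :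
    (Measure.count.restrict S : Measure E3).restrict ↑B = Measure.count.restrict ↑B := by
  rw [Measure.restrict_restrict B.measurableSet, inter_eq_left.mpr hB]

/-- every function is integrable on a finite set of atoms. [folklore] -/
theorem integrableOn_coe_finset {S : Set E3} (B : Finset E3) (hB : (↑B : Set E3) ⊆ S) (f : E3 → ℝ) :
    IntegrableOn f ↑B (Measure.count.restrict S : Measure E3) := by
  rw [IntegrableOn, restrict_coe_finset_eq B hB, count_restrict_coe_finset]
  exact integrable_finsetSum_measure.2 fun z _ => integrable_dirac (by simp)

/-- ★★ **WINDOW PLUS TAIL.**  `S ∋ 0` `δ`-separated, `W ⊆ S ∖ {0}` finite, every other atom `≥ R` from the root (`1 ≤ R`, `δ/2 ≤ R`):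
`Σ_{z ∈ W} V_LJ ‖z‖ − (1/6)·Env₆(δ, R) ≤ 2·rootEnergy V_LJ (count⌊S)` — and in particular `V_LJ ‖·‖` IS integrable on `count⌊S`, so
`rootEnergy` carries no junk value here. [folklore] -/
theorem sum_sub_env_le_two_mul_rootEnergy {S : Set E3} {δ R : ℝ} (hδ : 0 < δ)
    (hS : ∀ p ∈ S, ∀ p' ∈ S, p ≠ p' → δ ≤ dist p p') (h0 : (0 : E3) ∈ S) (W : Finset E3)
    (hW : (↑W : Set E3) ⊆ S) (h0W : (0 : E3) ∉ W) (hfar : ∀ z ∈ S, z ∉ W → z ≠ 0 → R ≤ ‖z‖)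
    (hR1 : 1 ≤ R) (hR : δ / 2 ≤ R) :
    ∑ z ∈ W, lennardJones ‖z‖
        - 1 / 6 * ((2 / δ) ^ 3 * R⁻¹ ^ 3 + 15 / 2 * (2 / δ) ^ 2 * R⁻¹ ^ 4 + 3 / 5 * (2 / δ) * R⁻¹ ^ 5 + 2 * R⁻¹ ^ 6) ≤
      2 * rootEnergy lennardJones (Measure.count.restrict S : Measure E3) := by
  classical
  set μ : Measure E3 := Measure.count.restrict S with hμ
  set B : Finset E3 := insert 0 W with hB
  have hBS : (↑B : Set E3) ⊆ S := by
    rw [hB, Finset.coe_insert]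
    exact insert_subset h0 hW
  have hBm : MeasurableSet (↑B : Set E3) := B.measurableSet
  -- the far atoms
  have hfar' : ∀ z ∈ (↑B : Set E3)ᶜ ∩ S, R ≤ ‖z‖ := by
    intro z hz
    have hzB : z ∉ B := fun h => hz.1 (Finset.mem_coe.mpr h)
    rw [hB, Finset.mem_insert, not_or] at hzB
    exact hfar z hz.2 hzB.2 hzB.1
  -- integrability on the whole configuration
  have hIB : IntegrableOn (fun z : E3 => lennardJones ‖z‖) ↑B μ := integrableOn_coe_finset B hBS _
  have hIA : IntegrableOn (fun z : E3 => lennardJones ‖z‖) (↑B)ᶜ μ := by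
    refine ⟨measurable_lennardJones_norm.aestronglyMeasurable, ?_⟩
    refine lt_of_le_of_lt (setLIntegral_enorm_lennardJones_le_env hδ hS hBm.compl hfar' hR1 hR) ENNReal.ofReal_lt_top
  have hI : Integrable (fun z : E3 => lennardJones ‖z‖) μ := by
    have h := hIB.union hIA
    rwa [union_compl_self, integrableOn_univ] at h
  -- split
  have hsplit := integral_add_compl hBm hI
  have hwin : ∫ z in ↑B, lennardJones ‖z‖ ∂μ = ∑ z ∈ W, lennardJones ‖z‖ := by
    rw [restrict_coe_finset_eq B hBS, integral_count_restrict_coe_finset, hB, Finset.sum_insert h0W]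
    simp [lennardJones]
  have htail := neg_env_le_setIntegral_lennardJones hδ hS hBm.compl hfar' hR1 hR
  rw [rootEnergy_def, ← hsplit, hwin]
  linarith

/-- the same bound with the window sum written through `φ`: `Σ_{z ∈ W} φ(‖z‖²) − (1/6)·Env₆ ≤ 2·rootEnergy` (`V_LJ r = φ(r²)`, (226)
`lennardJones_eq_phiT`) — the form the K readings `drows_•_sound` consume once (s1) identifies the window sum with the booked histogram sum. [folklore] -/
theorem sum_phiT_sub_env_le_two_mul_rootEnergy {S : Set E3} {δ R : ℝ} (hδ : 0 < δ)
    (hS : ∀ p ∈ S, ∀ p' ∈ S, p ≠ p' → δ ≤ dist p p') (h0 : (0 : E3) ∈ S) (W : Finset E3)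
    (hW : (↑W : Set E3) ⊆ S) (h0W : (0 : E3) ∉ W) (hfar : ∀ z ∈ S, z ∉ W → z ≠ 0 → R ≤ ‖z‖)
    (hR1 : 1 ≤ R) (hR : δ / 2 ≤ R) :
    ∑ z ∈ W, FrustratedLawDichotomyCoherentFloorAlgebra.phiT (‖z‖ ^ 2)
        - 1 / 6 * ((2 / δ) ^ 3 * R⁻¹ ^ 3 + 15 / 2 * (2 / δ) ^ 2 * R⁻¹ ^ 4 + 3 / 5 * (2 / δ) * R⁻¹ ^ 5 + 2 * R⁻¹ ^ 6) ≤
      2 * rootEnergy lennardJones (Measure.count.restrict S : Measure E3) := by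
  have h := sum_sub_env_le_two_mul_rootEnergy hδ hS h0 W hW h0W hfar hR1 hR
  have e : ∑ z ∈ W, FrustratedLawDichotomyCoherentFloorAlgebra.phiT (‖z‖ ^ 2) = ∑ z ∈ W, lennardJones ‖z‖ :=
    Finset.sum_congr rfl fun z _ => (FrustratedLawDichotomyCoherentFloor.lennardJones_eq_phiT ‖z‖).symm
  rw [e]; exact h

end Summit.AtomisticToContinuum.Crystallization.Theorems.FrustratedLawDichotomyDRowsAssembly
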